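import Mathlib
import Summits.AnomalousDissipation.AnomalousDissipation.Theses.PointSink
import Summits.AnomalousDissipation.AnomalousDissipation.Theorems.NegSteadyThinSetLiouville

/-!
# No TAME point sink: a negative lemma for the crux `PointSink.SolitonTransplant`
(stmt-AnomalousDissipation-19035; conclusion = target `PointSinkZerothLaw`, stmt-19032)

Refuter crux-attack record (route `AnomalousDissipation/PointSink`). The crux is
`CascadeSoliton → PointSinkZerothLaw`; its intended proof (birth skeleton: SINK COMPLETION +
VISCOUS REALISATION) produces the steady `NS_{ν_k}` states `u_k` as perturbations of a completed
steady Euler field `U` on `T³` (the rescaled cone `A·V` near the sink `x₀`, a designed field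
elsewhere, `f :=` the smooth Euler residual) with `u_k → U` as `ν_k → 0`.

The landed thin-set Liouville theorem (`ThinSetLiouville.steadyNegTameOffThinSets_proof`,
stmt-AnomalousDissipation-1049, resting on `steadyThinSetLiouville`, stmt-1047) constrains every such
proof: if the family converges pointwise off a closed set `S` of Minkowski codimension `≥ 2`
(`volume S_ρ ≤ C ρ²`) to a pair `(U, P)` that is `C¹` off `S` and solves steady Euler with the same
force there, then `ν_j ‖∇u_j‖₂² → 0` — no dissipation floor. We record the two consequences a
prover of the crux must design around:

* `dissipationFloor_false_of_tame` — the floor clause `∃ ε > 0, ∀ j, ε ≤ ν_j ‖∇u_j‖₂²` of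
  `PointSinkZerothLaw` is incompatible with tame convergence off ANY codimension-2 thin closed set;
  since points and finitely many segments (singular RAYS of a cone) are such sets
  (`volume_thickening_singleton_le` for the point), the limit profile `U` must be singular on a
  codimension-`< 2` set (sheets, or convex-integration roughness), not merely non-`C¹` at the sink
  or along rays;
* `dissipationFloor_false_of_tame_singleton` — the special case `S = {x₀}`: a completion that is
  `C¹` off the sink alone does no work (the planner's own why-might-fail, now kernel-checked).

Classification: negative lemma (no verdict change; the crux is refutable only together with a
proof of `CascadeSoliton`). [folklore]
-/

set_option linter.dupNamespace false  -- `Summit.AnomalousDissipation.AnomalousDissipation` is the mandated summit/problem namespace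

noncomputable section

open MeasureTheory Metric Filter Topology Set
open Literature.Analysis.FunctionSpaces

namespace Summit.AnomalousDissipation.AnomalousDissipation.Theorems.SolitonTransplant.Negative

/-- A point of the flat torus `T³` is a codimension-`≥ 2` thin set in the sense of
`SteadyNegTameOffThinSets`: `volume ({x₀}_ρ) ≤ 4ρ²` for every `ρ > 0` (the `ρ`-thickening is the
sup-metric ball, a product of three arcs of length `≤ min (1, 2ρ)`, and
`min(1,2ρ)³ ≤ (2ρ)² · 1`). [folklore] -/
theorem volume_thickening_singleton_le (x₀ : UnitAddTorus (Fin 3)) {ρ : ℝ} (hρ : 0 < ρ) :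
    volume (thickening ρ ({x₀} : Set (UnitAddTorus (Fin 3)))) ≤ ENNReal.ofReal (4 * ρ ^ 2) := by
  have hm0 : 0 ≤ min 1 (2 * ρ) := le_min zero_le_one (by linarith)
  have h1 : ∀ i, volume (closedBall (x₀ i) ρ) ≤ ENNReal.ofReal (min 1 (2 * ρ)) := fun i => by
    rw [AddCircle.volume_closedBall]
  calc volume (thickening ρ ({x₀} : Set (UnitAddTorus (Fin 3))))
        ≤ volume (closedBall x₀ ρ) := by
          rw [thickening_singleton]
          exact measure_mono ball_subset_closedBall
    _ = ∏ i, volume (closedBall (x₀ i) ρ) := volume_pi_closedBall x₀ hρ.le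
    _ ≤ ∏ _i : Fin 3, ENNReal.ofReal (min 1 (2 * ρ)) := Finset.prod_le_prod' fun i _ => h1 i
    _ = ENNReal.ofReal ((min 1 (2 * ρ)) ^ 3) := by
          rw [Finset.prod_const, Finset.card_univ, Fintype.card_fin, ENNReal.ofReal_pow hm0]
    _ ≤ ENNReal.ofReal (4 * ρ ^ 2) := by
          refine ENNReal.ofReal_le_ofReal ?_
          have ha : min 1 (2 * ρ) ≤ 1 := min_le_left _ _
          have hb : min 1 (2 * ρ) ≤ 2 * ρ := min_le_right _ _
          have h2 : (min 1 (2 * ρ)) ^ 2 ≤ (2 * ρ) ^ 2 := pow_le_pow_left₀ hm0 hb 2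
          have h3 : (min 1 (2 * ρ)) ^ 3 ≤ (min 1 (2 * ρ)) ^ 2 := by
            calc (min 1 (2 * ρ)) ^ 3 = (min 1 (2 * ρ)) ^ 2 * min 1 (2 * ρ) := by ring
              _ ≤ (min 1 (2 * ρ)) ^ 2 * 1 := mul_le_mul_of_nonneg_left ha (sq_nonneg _)
              _ = (min 1 (2 * ρ)) ^ 2 := mul_one _
          nlinarith [h2, h3]

/-- **No tame point sink (general thin set).** In the setting of `PointSinkZerothLaw` — a fixed
smooth divergence-free mean-zero force `f` on `T³`, viscosities `ν_j > 0` with `ν_j → 0`, steady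
classical Navier–Stokes states `(u_j, p_j)` with `∫‖u_j‖² ≤ E` — suppose the states converge
pointwise off a closed set `S` with `volume S_ρ ≤ C ρ²` to a pair `(U, P)`, `C¹` off `S`, solving
`(U·∇)U + ∇P = f`, `div U = 0` off `S`. Then the dissipation floor `∃ ε > 0, ∀ j, ε ≤ ν_j‖∇u_j‖₂²`
FAILS. Immediate from the landed `ThinSetLiouville.steadyNegTameOffThinSets_proof` (stmt-1049).
[folklore] -/
theorem dissipationFloor_false_of_tame
    (f : UnitAddTorus (Fin 3) → EuclideanSpace ℝ (Fin 3)) (hf : Torus.IsSmooth f)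
    (hdiv : Torus.IsDivFree f) (hmean : Torus.HasZeroMean f)
    (ν : ℕ → ℝ) (u : ℕ → UnitAddTorus (Fin 3) → EuclideanSpace ℝ (Fin 3))
    (p : ℕ → UnitAddTorus (Fin 3) → ℝ) (hν : ∀ j, 0 < ν j) (hν0 : Tendsto ν atTop (𝓝 0))
    (hsol : ∀ j, Torus.IsClassicalNSSolutionOn Set.univ (ν j) (fun _ => f) (fun _ => u j)
      (fun _ => p j))
    (hE : ∃ E : ℝ, ∀ j, MeasureTheory.integral MeasureTheory.volume (fun x => ‖u j x‖ ^ 2) ≤ E)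
    (U : UnitAddTorus (Fin 3) → EuclideanSpace ℝ (Fin 3)) (P : UnitAddTorus (Fin 3) → ℝ)
    (S : Set (UnitAddTorus (Fin 3))) (hS : IsClosed S)
    (hthin : ∃ C : ℝ, ∀ ρ : ℝ, 0 < ρ → volume (thickening ρ S) ≤ ENNReal.ofReal (C * ρ ^ 2))
    (hU : ContDiffOn ℝ 1 (Torus.lift U) (Torus.proj ⁻¹' Sᶜ))
    (hP : ContDiffOn ℝ 1 (Torus.lift P) (Torus.proj ⁻¹' Sᶜ))
    (hEuler : ∀ x ∈ Sᶜ, Torus.convect U U x + Torus.gradient P x = f x)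
    (hdivU : ∀ x ∈ Sᶜ, Torus.divergence U x = 0)
    (hconv : ∀ x ∈ Sᶜ, Tendsto (fun j => u j x) atTop (𝓝 (U x))) :
    ¬ ∃ ε : ℝ, 0 < ε ∧ ∀ j, ε ≤ ν j * Torus.gradNormSq (u j) := by
  rintro ⟨ε, hε, hle⟩
  have ht : Tendsto (fun j => ν j * Torus.gradNormSq (u j)) atTop (𝓝 0) :=
    ThinSetLiouville.steadyNegTameOffThinSets_proof f hf hdiv hmean ν u p hν hν0 hsol hE U P S hS
      hthin hU hP hEuler hdivU hconv
  have hev : ∀ᶠ j in atTop, ν j * Torus.gradNormSq (u j) < ε := ht (Iio_mem_nhds hε)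
  obtain ⟨j, hj⟩ := hev.exists
  exact absurd (hle j) (not_le.mpr hj)

/-- **No tame point sink (the sink alone).** Same setting, with the exceptional set the single
sink `x₀`: if the steady states converge pointwise off `x₀` to a steady Euler pair `(U, P)` that is
`C¹` off `x₀`, the dissipation floor of `PointSinkZerothLaw` fails — a `C¹`-off-the-sink completion
does no anomalous work, so any proof of `SolitonTransplant` along the birth line needs a limit
field that is rough on a codimension-`< 2` set. [folklore] -/
theorem dissipationFloor_false_of_tame_singleton
    (f : UnitAddTorus (Fin 3) → EuclideanSpace ℝ (Fin 3)) (hf : Torus.IsSmooth f)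
    (hdiv : Torus.IsDivFree f) (hmean : Torus.HasZeroMean f) (x₀ : UnitAddTorus (Fin 3))
    (ν : ℕ → ℝ) (u : ℕ → UnitAddTorus (Fin 3) → EuclideanSpace ℝ (Fin 3))
    (p : ℕ → UnitAddTorus (Fin 3) → ℝ) (hν : ∀ j, 0 < ν j) (hν0 : Tendsto ν atTop (𝓝 0))
    (hsol : ∀ j, Torus.IsClassicalNSSolutionOn Set.univ (ν j) (fun _ => f) (fun _ => u j)
      (fun _ => p j))
    (hE : ∃ E : ℝ, ∀ j, MeasureTheory.integral MeasureTheory.volume (fun x => ‖u j x‖ ^ 2) ≤ E)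
    (U : UnitAddTorus (Fin 3) → EuclideanSpace ℝ (Fin 3)) (P : UnitAddTorus (Fin 3) → ℝ)
    (hU : ContDiffOn ℝ 1 (Torus.lift U) (Torus.proj ⁻¹' ({x₀} : Set (UnitAddTorus (Fin 3)))ᶜ))
    (hP : ContDiffOn ℝ 1 (Torus.lift P) (Torus.proj ⁻¹' ({x₀} : Set (UnitAddTorus (Fin 3)))ᶜ))
    (hEuler : ∀ x, x ≠ x₀ → Torus.convect U U x + Torus.gradient P x = f x)
    (hdivU : ∀ x, x ≠ x₀ → Torus.divergence U x = 0)
    (hconv : ∀ x, x ≠ x₀ → Tendsto (fun j => u j x) atTop (𝓝 (U x))) :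
    ¬ ∃ ε : ℝ, 0 < ε ∧ ∀ j, ε ≤ ν j * Torus.gradNormSq (u j) :=
  dissipationFloor_false_of_tame f hf hdiv hmean ν u p hν hν0 hsol hE U P {x₀} isClosed_singleton
    ⟨4, fun _ hρ => volume_thickening_singleton_le x₀ hρ⟩ hU hP
    (fun x hx => hEuler x hx) (fun x hx => hdivU x hx) (fun x hx => hconv x hx)

end Summit.AnomalousDissipation.AnomalousDissipation.Theorems.SolitonTransplant.Negative

end
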